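import Summits.BirchSwinnertonDyer.BirchSwinnertonDyer.Theorems.SylvesterTwoHeegnerIndexCMHalfLevelPackage
import Summits.BirchSwinnertonDyer.BirchSwinnertonDyer.Theorems.SylvesterTwoHeegnerIndexCMFlipBlockTwo
import HarnessLib

/-!
# (S7) of leaf (L1) at `p ≡ 7 (mod 9)`, crux `UpperOffV0HSYPlus` (stmt-BirchSwinnertonDyer-19804): THE HALF PAIR
# PACKAGE at `9pℓℓ′` — the half `χ_B`-sum of the doubly-derived CM point is `Γ_K`-invariant modulo `2`, GRANTED THE
# TOWER FIXING at `n = ℓℓ′`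

Skeleton of record VARIANT M (`Cruxes/UpperOffV0HSYPlus/Lines/coupled_variantM.lean` 406ca288e244d392), stub
`stub_layerL1Seven`; planner D507 (4), D510.  Twin of #S4 at the pair level (the binders `hQN` / `hP₁` of #F2
`flip_levelPair` for the HALF class `c′_B(ℓℓ′)`): with the rows' data at the level `9pℓℓ′` (coupled frame, pinned `κ`,
coherent `emb₀ ⊂ emb`, `N₀ ⊇ N`, `H`, lifts `T`, product representatives `t`, generators `σ = σ_ℓ`, `σ′ = σ_{ℓ′}`,
HSY's points `y = y_{ℓℓ′}`, `y_ℓ`, `y_{ℓ′}` read at that level), the bottom involution datum (`s`, `s² = 1`, a half `H′`) AND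
THE TOWER FIXING AT `n = ℓℓ′` — `φ ∈ Aut_K K[9pℓℓ′]` restricting to `s` on `K[9p]` with `φ · y = y` (memo two §67.2
(W2-b); displayed as the binders `φ / hφs / hφy`, NOT proved, NOT in the tree):

`half_chiComponentB_pair_mem_invPoints`: the half sum `Σ_{(q,h′)} ρ_{t(q,h′)}(t(q,h′) • κ⁻¹ ι_e(D_ℓ D_{ℓ′} y))` lies in
`E₉(K̄)^N` and its `ψ_B`-image in `invPoints Γ_K ψ_B(E₉(K̄)^N) 2` (#S3 half transversal; #R-f at the pair level
`exists_fixedPoints_zsmul_eq_smul_map_derivOp_derivOp_sub` on `N₀`; the lift `φ̃` of `φ` fixes `D_ℓ D_{ℓ′} y` since `φ`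
commutes with `σ, σ′` in the abelian `Gal(K[9pℓℓ′]/K)`; #S4's dichotomy lemma; k-ty1's invariance law).

HONEST LABEL: theorems only (no `def`, no `sorry`, no new `Prop`); conditional on the displayed TOWER FIXING binders
(cell lemma W2-b, unrefereed); nothing asserted on 19804; no stub closed; X12.CMAtTwo NOT proved; BSD is not proved by
any of this.  `set_option maxHeartbeats 1600000 in` scoped to the one theorem.
`--supports stmt-BirchSwinnertonDyer-19804 --as helper`.
-/

set_option linter.dupNamespace false
set_option autoImplicit false

noncomputable section

open scoped Classical Pointwise

namespace Summit.BirchSwinnertonDyer.BirchSwinnertonDyer.Theorems.SylvesterTwoCMHalf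

open WeierstrassCurve WeierstrassCurve.Affine.Point Field NumberField IsDedekindDomain Finset
open Literature.NumberTheory.EllipticCurves Literature.NumberTheory.GaloisRepresentations
  Literature.NumberTheory.EllipticCurves.ModularForms
  Literature.NumberTheory.EllipticCurves.HuShuYin2019
  Literature.NumberTheory.EllipticCurves.KolyvaginCocycle
  Summit.BirchSwinnertonDyer.BirchSwinnertonDyer.Theorems.SylvesterTwoCMData
  Summit.BirchSwinnertonDyer.BirchSwinnertonDyer.Theorems.SylvesterTwoCMFlip
  Literature.NumberTheory.EllipticCurves.RingClassField
  Summit.BirchSwinnertonDyer.Rank1Residual.X11b Summit.BirchSwinnertonDyer.Rank1Residual.X11b.RingClassTower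

variable {K : Type} [Field K] [NumberField K]

/-- **A `K`-automorphism of `K[m]` fixing `y` fixes `D_ℓ D_{ℓ′} y`** (`Gal(K[m]/K)` is abelian, so it commutes
with the generators `σ_ℓ, σ_{ℓ′}`; #F2a `pointGalHom_derivOp_comm`). [cite: GrossLMS1991, §3 (3.5)–(3.7)] -/
theorem pointGalHom_derivOp_derivOp_eq_of_apply_eq (hK : IsImaginaryQuadratic K) (ι : K →+* ℂ) {m m₁ m₂ : ℕ}
    {σ σ' : ringClassField K ι m ≃ₐ[ℚ] ringClassField K ι m}
    (hσ : Subgroup.zpowers σ = ringClassGalOver ι m m₁) (hσ' : Subgroup.zpowers σ' = ringClassGalOver ι m m₂)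
    (φ : ringClassField K ι m ≃ₐ[K] ringClassField K ι m) (ℓ ℓ' : ℕ)
    {y : ((⟨0, 0, 1, 0, -1⟩ : WeierstrassCurve ℚ).baseChange (ringClassField K ι m)).toAffine.Point}
    (hφy : pointGalHom (⟨0, 0, 1, 0, -1⟩ : WeierstrassCurve ℚ) (ringClassField K ι m) (φ.restrictScalars ℚ) y = y) :
    pointGalHom (⟨0, 0, 1, 0, -1⟩ : WeierstrassCurve ℚ) (ringClassField K ι m) (φ.restrictScalars ℚ)
      (KolyvaginOperator.derivOp (pointGalHom (⟨0, 0, 1, 0, -1⟩ : WeierstrassCurve ℚ) (ringClassField K ι m)) σ ℓ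
        (KolyvaginOperator.derivOp (pointGalHom (⟨0, 0, 1, 0, -1⟩ : WeierstrassCurve ℚ) (ringClassField K ι m)) σ' ℓ' y)) =
      KolyvaginOperator.derivOp (pointGalHom (⟨0, 0, 1, 0, -1⟩ : WeierstrassCurve ℚ) (ringClassField K ι m)) σ ℓ
        (KolyvaginOperator.derivOp (pointGalHom (⟨0, 0, 1, 0, -1⟩ : WeierstrassCurve ℚ) (ringClassField K ι m)) σ' ℓ' y) := by
  have hφG : φ.restrictScalars ℚ ∈ ringClassGal ι m :=
    (mem_ringClassGal_iff_forall_apply_algebraMap ι _ _).mpr fun k ↦ φ.commutes k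
  have hc : ∀ {τ : ringClassField K ι m ≃ₐ[ℚ] ringClassField K ι m} {k : ℕ},
      Subgroup.zpowers τ = ringClassGalOver ι m k → Commute (φ.restrictScalars ℚ) τ := by
    intro τ k hτ
    have hτG : τ ∈ ringClassGal ι m := ringClassGalOver_le_ringClassGal ι _ _ (hτ ▸ Subgroup.mem_zpowers τ)
    exact congrArg Subtype.val
      ((KolyvaginH44.isMulCommutative_ringClassGal' hK ι m).is_comm.comm ⟨_, hφG⟩ ⟨_, hτG⟩)
  rw [pointGalHom_derivOp_comm _ (hc hσ), pointGalHom_derivOp_comm _ (hc hσ'), hφy]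

set_option maxHeartbeats 1600000 in
/-- **THE HALF PAIR PACKAGE at `9pℓℓ′`**: the half `χ_B`-sum of `κ⁻¹ ι_e(D_ℓ D_{ℓ′} y_{ℓℓ′})` lies in `E₉(K̄)^N` and is
`Γ_K`-invariant modulo `2 ψ_B(E₉(K̄)^N)`, granted the TOWER FIXING at `n = ℓℓ′`.
[cite: GrossLMS1991, §3 (3.5)–(3.7), Prop. 3.6, §4 (4.1)–(4.4), Lemma 4.3] [cite: HuShuYin2019, §2 Prop. 2.4] -/
theorem half_chiComponentB_pair_mem_invPoints {ω : K} (hω : ω ^ 2 + ω + 1 = 0) (h2 : Module.finrank ℚ K = 2)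
    (ι : K →+* ℂ) (Dt : ModularParametrizationData (⟨0, 0, 1, 0, -1⟩ : WeierstrassCurve ℚ) 243)
    {p ℓ ℓ' : ℕ} (hp : p.Prime) (hp3 : p % 3 = 1)
    (hKol : ℓ.Prime ∧ ¬ ℓ ∣ (cubeSumCurve (3 * (p : ℚ) ^ 2)).conductorNorm ℤ ∧
      ¬ ℓ ∣ (cubeSumCurve (p : ℚ)).conductorNorm ℤ ∧ ¬ ((ℓ : ℤ) ∣ NumberField.discr K) ∧ ℓ ≠ 2 ∧
      (Ideal.span {(ℓ : 𝓞 K)}).IsPrime ∧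
      FrobEqFrobInfty (cubeSumCurve (3 * (p : ℚ) ^ 2)) K 2 ℓ ∧ FrobEqFrobInfty (cubeSumCurve (p : ℚ)) K 2 ℓ)
    (hKol' : ℓ'.Prime ∧ ¬ ℓ' ∣ (cubeSumCurve (3 * (p : ℚ) ^ 2)).conductorNorm ℤ ∧
      ¬ ℓ' ∣ (cubeSumCurve (p : ℚ)).conductorNorm ℤ ∧ ¬ ((ℓ' : ℤ) ∣ NumberField.discr K) ∧ ℓ' ≠ 2 ∧
      (Ideal.span {(ℓ' : 𝓞 K)}).IsPrime ∧
      FrobEqFrobInfty (cubeSumCurve (3 * (p : ℚ) ^ 2)) K 2 ℓ' ∧ FrobEqFrobInfty (cubeSumCurve (p : ℚ)) K 2 ℓ')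
    (hne : ℓ ≠ ℓ')
    (κ : geomPoints ((cubeSumCurve 9).baseChange K) ≃+
      geomPoints ((⟨0, 0, 1, 0, -1⟩ : WeierstrassCurve ℚ).baseChange K))
    (hκG : ∀ (g : absoluteGaloisGroup K) (P : geomPoints ((cubeSumCurve 9).baseChange K)),
      κ (g • P) = g • κ P)
    {vB vA : AlgebraicClosure K} (hvBc : vB ^ 3 = algebraMap ℚ (AlgebraicClosure K) ((p : ℚ) / 9))
    (hvB : vB ≠ 0) (hvAc : vA ^ 3 = algebraMap ℚ (AlgebraicClosure K) ((p : ℚ) ^ 2 / 3))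
    (hvB3 : ∀ g : absoluteGaloisGroup K,
      ((show AlgebraicClosure K ≃ₐ[K] AlgebraicClosure K from g) vB) ^ 3 = vB ^ 3)
    {ψB : geomPoints ((cubeSumCurve 9).baseChange K) ≃+ geomPoints ((cubeSumCurve (p : ℚ)).baseChange K)}
    {ρ : absoluteGaloisGroup K →
      geomPoints ((cubeSumCurve 9).baseChange K) ≃+ geomPoints ((cubeSumCurve 9).baseChange K)}
    (hρ : ∀ (g : absoluteGaloisGroup K) {x y : AlgebraicClosure K}
        (h : (((cubeSumCurve 9).baseChange K).baseChange (AlgebraicClosure K)).toAffine.Nonsingular x y),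
        ∃ h', ρ g (Affine.Point.some x y h) =
          Affine.Point.some (((show AlgebraicClosure K ≃ₐ[K] AlgebraicClosure K from g) vB / vB) ^ 2 * x)
            y h')
    (hlawB : ∀ (g : absoluteGaloisGroup K) (P : geomPoints ((cubeSumCurve 9).baseChange K)),
        g • ψB P = ψB (ρ g (g • P)))
    -- the embedded bottom level and its fixer
    (emb₀ : ringClassField K ι (9 * p) →+* AlgebraicClosure K)
    (hemb₀ : ∀ k : K, emb₀ (algebraMap K (ringClassField K ι (9 * p)) k) = algebraMap K (AlgebraicClosure K) k)
    (N₀ : Subgroup (absoluteGaloisGroup K))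
    (hN₀ : ∀ g : absoluteGaloisGroup K, g ∈ N₀ ↔
      ∀ x : ringClassField K ι (9 * p), (show AlgebraicClosure K ≃ₐ[K] AlgebraicClosure K from g) (emb₀ x) = emb₀ x)
    {c₃ cp : ringClassField K ι (9 * p)} (hc₃ : c₃ ^ 3 = 3) (hcp : cp ^ 3 = (p : ringClassField K ι (9 * p)))
    (H : Subgroup (ringClassField K ι (9 * p) ≃ₐ[K] ringClassField K ι (9 * p)))
    (hH : ∀ σ, σ ∈ H ↔ σ c₃ = c₃ ∧ σ cp = cp)
    [Fintype ((ringClassField K ι (9 * p) ≃ₐ[K] ringClassField K ι (9 * p)) ⧸ H)] [Fintype H]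
    (T : (ringClassField K ι (9 * p) ≃ₐ[K] ringClassField K ι (9 * p)) → absoluteGaloisGroup K)
    (hT : ∀ σ (x : ringClassField K ι (9 * p)),
      (show AlgebraicClosure K ≃ₐ[K] AlgebraicClosure K from T σ) (emb₀ x) = emb₀ (σ x))
    (t : ((ringClassField K ι (9 * p) ≃ₐ[K] ringClassField K ι (9 * p)) ⧸ H) × H → absoluteGaloisGroup K)
    (ht' : ∀ q h, t (q, h) = T (Quotient.out q) * T (h : _))
    -- the involution datum at the bottom: `s ∈ H`, `s² = 1`, a half `H′`
    (s : H) (hs2 : s * s = 1) (H' : Finset H) (hH' : ∀ h : H, Xor (h ∈ H') (h * s ∈ H'))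
    -- the level `9pℓℓ′`: coherent embedding, point map, fixer, the two generators, HSY's three points
    (hle₀2 : ringClassField K ι (9 * p) ≤ ringClassField K ι (9 * p * (ℓ * ℓ')))
    (emb : ringClassField K ι (9 * p * (ℓ * ℓ')) →+* AlgebraicClosure K)
    (hemb : ∀ k : K, emb (algebraMap K (ringClassField K ι (9 * p * (ℓ * ℓ'))) k) =
      algebraMap K (AlgebraicClosure K) k)
    (hcoh₀2 : ∀ x : ringClassField K ι (9 * p), emb (RingClassField.inclusion ι hle₀2 x) = emb₀ x)
    (ιe : letI : DecidableEq (ringClassField K ι (9 * p * (ℓ * ℓ'))) := fun a b ↦ Classical.propDecidable (a = b)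
      ((⟨0, 0, 1, 0, -1⟩ : WeierstrassCurve ℚ).baseChange (ringClassField K ι (9 * p * (ℓ * ℓ')))).toAffine.Point →+
        geomPoints ((⟨0, 0, 1, 0, -1⟩ : WeierstrassCurve ℚ).baseChange K))
    (hιe : ∀ P, ιe P = Affine.Point.map (W' := (⟨0, 0, 1, 0, -1⟩ : WeierstrassCurve ℚ)) emb.toRatAlgHom P)
    (N : Subgroup (absoluteGaloisGroup K))
    (hN : ∀ g : absoluteGaloisGroup K, g ∈ N ↔
      ∀ x : ringClassField K ι (9 * p * (ℓ * ℓ')),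
        (show AlgebraicClosure K ≃ₐ[K] AlgebraicClosure K from g) (emb x) = emb x)
    {σ σ' : ringClassField K ι (9 * p * (ℓ * ℓ')) ≃ₐ[ℚ] ringClassField K ι (9 * p * (ℓ * ℓ'))}
    (hσ : Subgroup.zpowers σ = ringClassGalOver ι (9 * p * (ℓ * ℓ')) (9 * p * ℓ'))
    (hσ' : Subgroup.zpowers σ' = ringClassGalOver ι (9 * p * (ℓ * ℓ')) (9 * p * ℓ))
    {y yℓ yℓ' : ((⟨0, 0, 1, 0, -1⟩ : WeierstrassCurve ℚ).baseChange (ringClassField K ι (9 * p * (ℓ * ℓ')))).toAffine.Point}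
    (hy : Affine.Point.map (W' := (⟨0, 0, 1, 0, -1⟩ : WeierstrassCurve ℚ))
        (ringClassField K ι (9 * p * (ℓ * ℓ'))).subtype.toRatAlgHom y =
      Dt.φ (heegnerTau (((ℓ * ℓ' : ℕ) : ℤ) ^ 2 * (81 * ((p : ℤ) ^ 2 + 4 * p + 16)),
        ((ℓ * ℓ' : ℕ) : ℤ) * (-(9 * (4 * (p : ℤ) ^ 2 + 17 * p + 72))), 4 * (p : ℤ) ^ 2 + 18 * p + 81)))
    (hyℓ : Affine.Point.map (W' := (⟨0, 0, 1, 0, -1⟩ : WeierstrassCurve ℚ))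
        (ringClassField K ι (9 * p * (ℓ * ℓ'))).subtype.toRatAlgHom yℓ =
      Dt.φ (heegnerTau ((ℓ : ℤ) ^ 2 * (81 * ((p : ℤ) ^ 2 + 4 * p + 16)),
        (ℓ : ℤ) * (-(9 * (4 * (p : ℤ) ^ 2 + 17 * p + 72))), 4 * (p : ℤ) ^ 2 + 18 * p + 81)))
    (hyℓ' : Affine.Point.map (W' := (⟨0, 0, 1, 0, -1⟩ : WeierstrassCurve ℚ))
        (ringClassField K ι (9 * p * (ℓ * ℓ'))).subtype.toRatAlgHom yℓ' =
      Dt.φ (heegnerTau ((ℓ' : ℤ) ^ 2 * (81 * ((p : ℤ) ^ 2 + 4 * p + 16)),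
        (ℓ' : ℤ) * (-(9 * (4 * (p : ℤ) ^ 2 + 17 * p + 72))), 4 * (p : ℤ) ^ 2 + 18 * p + 81)))
    -- THE TOWER FIXING at `n = ℓℓ′` (W2-b; displayed, not proved): a lift `φ` of `s` to `K[9pℓℓ′]` fixing `y`
    (φ : ringClassField K ι (9 * p * (ℓ * ℓ')) ≃ₐ[K] ringClassField K ι (9 * p * (ℓ * ℓ')))
    (hφs : ∀ x : ringClassField K ι (9 * p),
      φ (RingClassField.inclusion ι hle₀2 x) =
        RingClassField.inclusion ι hle₀2 ((s : ringClassField K ι (9 * p) ≃ₐ[K] ringClassField K ι (9 * p)) x))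
    (hφy : pointGalHom (⟨0, 0, 1, 0, -1⟩ : WeierstrassCurve ℚ) (ringClassField K ι (9 * p * (ℓ * ℓ')))
      (φ.restrictScalars ℚ) y = y) :
    (∑ i : ((ringClassField K ι (9 * p) ≃ₐ[K] ringClassField K ι (9 * p)) ⧸ H) × H',
        ρ (t (i.1, (i.2 : H))) (t (i.1, (i.2 : H)) •
          κ.symm (ιe (KolyvaginOperator.derivOp
            (pointGalHom (⟨0, 0, 1, 0, -1⟩ : WeierstrassCurve ℚ) (ringClassField K ι (9 * p * (ℓ * ℓ')))) σ ℓ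
            (KolyvaginOperator.derivOp
              (pointGalHom (⟨0, 0, 1, 0, -1⟩ : WeierstrassCurve ℚ) (ringClassField K ι (9 * p * (ℓ * ℓ')))) σ' ℓ' y))))) ∈
      FixedPoints.addSubgroup N (geomPoints ((cubeSumCurve 9).baseChange K)) ∧
    ψB (∑ i : ((ringClassField K ι (9 * p) ≃ₐ[K] ringClassField K ι (9 * p)) ⧸ H) × H',
        ρ (t (i.1, (i.2 : H))) (t (i.1, (i.2 : H)) •
          κ.symm (ιe (KolyvaginOperator.derivOp
            (pointGalHom (⟨0, 0, 1, 0, -1⟩ : WeierstrassCurve ℚ) (ringClassField K ι (9 * p * (ℓ * ℓ')))) σ ℓ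
            (KolyvaginOperator.derivOp
              (pointGalHom (⟨0, 0, 1, 0, -1⟩ : WeierstrassCurve ℚ) (ringClassField K ι (9 * p * (ℓ * ℓ')))) σ' ℓ' y))))) ∈
      invPoints (absoluteGaloisGroup K)
        ((FixedPoints.addSubgroup N (geomPoints ((cubeSumCurve 9).baseChange K))).map ψB.toAddMonoidHom)
        ((2 : ℕ) : ℤ) := by
  -- ### basics from the clauses
  obtain ⟨hℓ, -, -, hℓdK, hℓ2, hinert, -, hFrobB⟩ := hKol
  obtain ⟨hℓ', -, -, hℓ'dK, hℓ'2, hinert', -, hFrobB'⟩ := hKol'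
  obtain ⟨hℓ3, hℓp⟩ := mod_three_eq_two_of_clause hω h2 hp hp3 hℓ hℓdK hFrobB
  obtain ⟨hℓ'3, hℓ'p⟩ := mod_three_eq_two_of_clause hω h2 hp hp3 hℓ' hℓ'dK hFrobB'
  have hK := JZero.isImaginaryQuadratic_of_sq_add_self_add_one hω h2
  have hdK := JZero.discr_eq_neg_three_of_sq_add_self_add_one hω h2
  have hp0 : p ≠ 0 := hp.ne_zero
  have hℓ3' : ℓ ≠ 3 := by rintro rfl; norm_num at hℓ3
  have hℓ'3' : ℓ' ≠ 3 := by rintro rfl; norm_num at hℓ'3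
  have hℓ_odd : Odd ℓ := hℓ.eq_two_or_odd'.resolve_left hℓ2
  have hℓ'_odd : Odd ℓ' := hℓ'.eq_two_or_odd'.resolve_left hℓ'2
  haveI := isElliptic_sylvesterNineMinimal
  haveI := isGloballyMinimal_sylvesterNineMinimal
  have hΔ := not_dvd_minimalDiscriminantInt_sylvesterNineMinimal hℓ hℓ3'
  have hΔ' := not_dvd_minimalDiscriminantInt_sylvesterNineMinimal hℓ' hℓ'3'
  have hMa : ((2 ^ 1 : ℕ) : ℤ) ∣ (⟨0, 0, 1, 0, -1⟩ : WeierstrassCurve ℚ).LFunction ℓ := by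
    rw [JZero.lFunction_eq_zero_of_j_eq_zero_of_mod_three_eq_two _ j_sylvesterNineMinimal hℓ hℓ3 hℓ2 hΔ]
    exact dvd_zero _
  have hMa' : ((2 ^ 1 : ℕ) : ℤ) ∣ (⟨0, 0, 1, 0, -1⟩ : WeierstrassCurve ℚ).LFunction ℓ' := by
    rw [JZero.lFunction_eq_zero_of_j_eq_zero_of_mod_three_eq_two _ j_sylvesterNineMinimal hℓ' hℓ'3 hℓ'2 hΔ']
    exact dvd_zero _
  have hMℓ : 2 ^ 1 ∣ ℓ + 1 := by rw [pow_one]; exact hℓ_odd.add_one.two_dvd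
  have hMℓ' : 2 ^ 1 ∣ ℓ' + 1 := by rw [pow_one]; exact hℓ'_odd.add_one.two_dvd
  have hn0 : 9 * p * (ℓ * ℓ') ≠ 0 := mul_ne_zero (mul_ne_zero (by norm_num) hp0) (mul_ne_zero hℓ.ne_zero hℓ'.ne_zero)
  haveI := (finiteDimensional_and_isGalois_ringClassField hK ι hn0).1
  haveI := (finiteDimensional_and_isGalois_ringClassField hK ι hn0).2
  haveI hNn : N.Normal := normal_of_mem_iff emb hemb N hN
  have hN₀2 := mem_iff_forall_mem_nine_mul ι hle₀2 emb₀ emb hcoh₀2 hN₀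
  -- ### the pair point `P = κ⁻¹ ι_e(D_ℓ D_ℓ′ y)`: `N`-fixed, `N₀`-invariant mod `2` (Gross 3.6 at the pair level)
  set P := κ.symm (ιe (KolyvaginOperator.derivOp
    (pointGalHom (⟨0, 0, 1, 0, -1⟩ : WeierstrassCurve ℚ) (ringClassField K ι (9 * p * (ℓ * ℓ')))) σ ℓ
    (KolyvaginOperator.derivOp
      (pointGalHom (⟨0, 0, 1, 0, -1⟩ : WeierstrassCurve ℚ) (ringClassField K ι (9 * p * (ℓ * ℓ')))) σ' ℓ' y))) with hP
  have hPN := map_emb_mem_fixedPoints (⟨0, 0, 1, 0, -1⟩ : WeierstrassCurve ℚ) ι emb ιe hιe N hN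
    (KolyvaginOperator.derivOp
      (pointGalHom (⟨0, 0, 1, 0, -1⟩ : WeierstrassCurve ℚ) (ringClassField K ι (9 * p * (ℓ * ℓ')))) σ ℓ
      (KolyvaginOperator.derivOp
        (pointGalHom (⟨0, 0, 1, 0, -1⟩ : WeierstrassCurve ℚ) (ringClassField K ι (9 * p * (ℓ * ℓ')))) σ' ℓ' y))
  have hPℓN : P ∈ FixedPoints.addSubgroup N (geomPoints ((cubeSumCurve 9).baseChange K)) :=
    mem_fixedPoints_symm_of_equivariant κ hκG N hPN
  have hPraw := exists_fixedPoints_zsmul_eq_smul_map_derivOp_derivOp_sub hK hdK ι Dt hp3 hℓ hℓ3 hℓ' hℓ'3 hne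
    hℓp hℓ'p hinert hinert' hMℓ hMℓ' hMa hMa' hσ hσ' hy hyℓ hyℓ' emb hemb ιe hιe N hN N₀ hN₀2
  have hP₀ : ∀ h ∈ N₀, ∃ a ∈ FixedPoints.addSubgroup N (geomPoints ((cubeSumCurve 9).baseChange K)),
      ((2 : ℕ) : ℤ) • a = h • P - P := fun h hh ↦ by
    have e := exists_fixedPoints_zsmul_eq_symm_of_equivariant κ hκG N (hPraw h hh)
    rwa [pow_one] at e
  -- ### the half fixer `N″` and the half transversal (#S3)
  obtain ⟨N'', -, hdich, -, hN''vB, -, ht''⟩ := exists_halfFixer hω h2 ι hp0 hvBc hvAc emb₀ hemb₀ N₀ hN₀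
    hc₃ hcp H hH T hT t ht' s hs2 H' hH'
  -- ### THE TOWER FIXING: a lift `φ̃ ∈ Γ_K` of `φ` restricts to `s` on `K[9p]` and FIXES `P`
  obtain ⟨φt, hφt⟩ := exists_lift_algEquiv emb hemb φ
  have hφt₀ : ∀ x : ringClassField K ι (9 * p),
      (show AlgebraicClosure K ≃ₐ[K] AlgebraicClosure K from φt) (emb₀ x) =
        emb₀ ((s : ringClassField K ι (9 * p) ≃ₐ[K] ringClassField K ι (9 * p)) x) := fun x ↦ by
    rw [← hcoh₀2, hφt, hφs, hcoh₀2]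
  have hfin := pointGalHom_derivOp_derivOp_eq_of_apply_eq hK ι hσ hσ' φ ℓ ℓ' hφy
  have hφP : φt • P = P := smul_symm_embPoints_eq_of_apply_eq emb κ hκG ιe hιe (φ.restrictScalars ℚ) hφt hfin
  have hP'' := exists_mem_zsmul_eq_smul_sub_of_dichotomy emb₀ hN₀
    (by rw [← Subgroup.coe_mul, hs2, Subgroup.coe_one]) hdich hφt₀ hφP hP₀
  -- ### conclude
  refine ⟨?_, ?_⟩
  · exact chiComponent_mem (fun g ↦ (ρ g).toAddMonoidHom) (fun g _ ha ↦ JZero.smul_mem_fixedPoints _ N g ha)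
      (fun g _ ha ↦ JZero.rho_mem_fixedPoints _ hω hvB hvB3 hρ N g ha)
      (fun i : ((ringClassField K ι (9 * p) ≃ₐ[K] ringClassField K ι (9 * p)) ⧸ H) × H' ↦ t (i.1, (i.2 : H))) hPℓN
  · exact JZero.cubicTwist_chiComponent_fixedPoints_mem_invPoints hω hvB hvB3 hρ hlawB N hN''vB
      (fun i : ((ringClassField K ι (9 * p) ≃ₐ[K] ringClassField K ι (9 * p)) ⧸ H) × H' ↦ t (i.1, (i.2 : H))) ht''
      hPℓN hP''

end Summit.BirchSwinnertonDyer.BirchSwinnertonDyer.Theorems.SylvesterTwoCMHalf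

end
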